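import Literature.NumberTheory.NumberFields.CyclotomicFieldFourValuations
import Literature.NumberTheory.NumberFields.CyclotomicFieldFourPrimes
import Mathlib.Tactic.NormNum.Prime
import HarnessLib

/-!
# The Gaussian valuation table of the `5`-descent of `E_{13/3}` over `ℚ(i)`: three places (one inert), four Kummer values

PROOF-ONLY file (theorems only, no definition, no named fact, no `sorry`), topic `NumberTheory/EllipticCurves`;
the arithmetic input of the instance `KubertTate133GaussianDescent`.  Carrier: any `K` with `IsCyclotomicExtension {4} ℚ K`
and a primitive fourth root of unity `ζ ∈ 𝓞 K = ℤ[i]`.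

`E = E_{13/3} = [-10, -39, -117, 0, 0]`, `mn = 39 = 3·13` with `3` INERT and `13 ≡ 1 (mod 4)` SPLIT in `ℤ[i]`: the places of
`ℚ(i)` above `mn` are `v₀ = (3)`, `v₁ = (2 + 3ζ)`, `v₂ = (2 − 3ζ)` (`exists_places`).  The Kummer values `f_T = xy − 3x² + 9y`:
of the `ℚ`-points `−T = (0, 117)` and `(105, 1617)` (`1053 = 3⁴·13`, `151263 = 3²·7⁵`), of the `ℚ(i)`-point
`Q = (-65/4, -91/4 + (949/8)ζ)` — the point `(u, Y) = (-65/4, 949/4)` of the quadratic twist `Y² = -(4u³ + b₂u² + 2b₄u + b₆)` of `E`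
by `-1` — which is `(−20072 − 27521ζ)/32` (the numerator is tabulated; `32 = 2⁵` is a unit at the three places), and of the
base point `2T = (39, 507)` (`19773 = 3²·13³`).  Orders at `(v₀, v₁, v₂)` (`log_valuation_points`, `log_valuation_base`;
Mathlib normalisation `log v = -ord_v`):

  `ord = [[4, 1, 1], [2, 0, 0], [0, 1, 4]]`, base `[2, 3, 3]`;

the twist row `[0, 1, 4]` (`N(−20072 − 27521ζ) = 5⁵·13⁵`) is not symmetric in `v₁, v₂` — which no `ℚ`-point achieves.
Also `int_add_int_mul_not_mem_span_natCast` — a norm certificate for non-membership in an inert place `(q)`: `q ∤ c² + e² ⟹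
c + eζ ∉ (q)`.  BSD is not proved by this.

## References

* [SilvermanAEC2009] J. H. Silverman, *AEC*, 2nd ed., Exercise 10.1(c), Thm. X.1.1.
* [IrelandRosen1982] K. Ireland, M. Rosen, *A Classical Introduction to Modern Number Theory*, Ch. 9 §7 Lemmas 4–5.
-/

noncomputable section

open scoped NumberField
open NumberField Ideal IsDedekindDomain Literature.NumberTheory.NumberFields

namespace Literature.NumberTheory.EllipticCurves

namespace KubertTate133GaussianDescent

variable {K : Type} [Field K] [NumberField K] [IsCyclotomicExtension {4} ℚ K] {ζ : 𝓞 K}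

omit [NumberField K] [IsCyclotomicExtension {4} ℚ K] in
/-- `ζ² + 1 = 0` in `𝓞 K`. [folklore] -/
private theorem sq_add_one_eq_zero (hζ : IsPrimitiveRoot ζ 4) : ζ ^ 2 + 1 = 0 := by
  rw [(hζ.pow (by norm_num) (show 4 = 2 * 2 by norm_num)).eq_neg_one_of_two_right, neg_add_cancel]

/-! ## §1 A norm certificate for inert places, and the three places of `ℚ(i)` above `mn = 3·13` -/

/-- **`q ∤ c² + e² ⟹ c + eζ ∉ (q)`** for a rational integer `q` (if `c + eζ = q·(w₁ + w₂ζ)` then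
`c² + e² = N(c + eζ) = (qw₁)² + (qw₂)²`). At an inert `q ≡ 3 (mod 4)` this is an equivalence (`-1` is not a square mod `q`).
[cite: IrelandRosen1982, Ch. 9 §7 Lemma 4] -/
theorem int_add_int_mul_not_mem_span_natCast (hζ : IsPrimitiveRoot ζ 4) {q : ℕ} {c e : ℤ}
    (h : ¬ (q : ℤ) ∣ c ^ 2 + e ^ 2) : (c : 𝓞 K) + e * ζ ∉ span {(q : 𝓞 K)} := by
  intro hmem
  rw [mem_span_singleton'] at hmem
  obtain ⟨w, hw⟩ := hmem
  obtain ⟨w₁, w₂, rfl⟩ := exists_int_add_int_mul_eq_four hζ w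
  have hN := congrArg (Algebra.norm ℤ) hw
  rw [show ((w₁ : 𝓞 K) + w₂ * ζ) * (q : 𝓞 K) = ((q * w₁ : ℤ) : 𝓞 K) + ((q * w₂ : ℤ) : 𝓞 K) * ζ by push_cast; ring,
    norm_int_add_int_mul_four hζ, norm_int_add_int_mul_four hζ] at hN
  exact h ⟨q * (w₁ ^ 2 + w₂ ^ 2), by linear_combination -hN⟩

/-- **The places `(3)`, `(2 ± 3ζ)` of `ℚ(i)`** (`3` is inert — prime in `ℤ[i]` —, `2 ± 3ζ` have norm `13`).
[cite: IrelandRosen1982, Ch. 9 §7 Lemmas 4 and 5] -/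
theorem exists_places (hζ : IsPrimitiveRoot ζ 4) :
    ∃ v₀ v₁ v₂ : HeightOneSpectrum (𝓞 K),
      v₀.asIdeal = span {(3 : 𝓞 K)} ∧ v₁.asIdeal = span {(2 : 𝓞 K) + 3 * ζ} ∧ v₂.asIdeal = span {(2 : 𝓞 K) - 3 * ζ} := by
  have p₀ : Prime (3 : 𝓞 K) := by
    simpa using prime_natCast_of_mod_four_eq_three (K := K) Nat.prime_three (by norm_num)
  have p₁ : Prime ((2 : 𝓞 K) + 3 * ζ) := by
    simpa using prime_int_add_int_mul_four hζ (a := 2) (b := 3) (ℓ := 13) (by norm_num) (by norm_num)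
  have p₂ : Prime ((2 : 𝓞 K) - 3 * ζ) := by
    have h := prime_int_add_int_mul_four hζ (a := 2) (b := -3) (ℓ := 13) (by norm_num) (by norm_num)
    have e : ((2 : ℤ) : 𝓞 K) + ((-3 : ℤ) : 𝓞 K) * ζ = (2 : 𝓞 K) - 3 * ζ := by push_cast; ring
    rwa [e] at h
  obtain ⟨v₀, h₀⟩ := exists_asIdeal_eq_span p₀
  obtain ⟨v₁, h₁⟩ := exists_asIdeal_eq_span p₁
  obtain ⟨v₂, h₂⟩ := exists_asIdeal_eq_span p₂
  exact ⟨v₀, v₁, v₂, h₀, h₁, h₂⟩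

/-! ## §2 The valuation table -/

section Table

variable (hζ : IsPrimitiveRoot ζ 4) {v₀ v₁ v₂ : HeightOneSpectrum (𝓞 K)}
  (hv₀ : v₀.asIdeal = span {(3 : 𝓞 K)}) (hv₁ : v₁.asIdeal = span {(2 : 𝓞 K) + 3 * ζ})
  (hv₂ : v₂.asIdeal = span {(2 : 𝓞 K) - 3 * ζ})

include hζ hv₀ hv₁ hv₂

omit [NumberField K] [IsCyclotomicExtension {4} ℚ K] in
/-- The rational primes `3, 13, 13` lie in the three places. [cite: IrelandRosen1982, Ch. 9 §7 Lemmas 4 and 5] -/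
theorem natCast_mem_places :
    ((3 : ℕ) : 𝓞 K) ∈ v₀.asIdeal ∧ ((13 : ℕ) : 𝓞 K) ∈ v₁.asIdeal ∧ ((13 : ℕ) : 𝓞 K) ∈ v₂.asIdeal := by
  have hsq := sq_add_one_eq_zero hζ
  refine ⟨?_, ?_, ?_⟩
  · rw [hv₀]; exact_mod_cast mem_span_singleton_self (3 : 𝓞 K)
  · rw [hv₁, mem_span_singleton]; exact ⟨(2 : 𝓞 K) - 3 * ζ, by push_cast; linear_combination (9 : 𝓞 K) * hsq⟩
  · rw [hv₂, mem_span_singleton]; exact ⟨(2 : 𝓞 K) + 3 * ζ, by push_cast; linear_combination (9 : 𝓞 K) * hsq⟩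

/-- **Orders of the Kummer values of `−T`, `(105, 1617)` and (the numerator of) the twist point `Q` at `(v₀, v₁, v₂)`**:
`[[4, 1, 1], [2, 0, 0], [0, 1, 4]]` (read as `log v = -ord`). [cite: SilvermanAEC2009, Exercise 10.1(c)] -/
theorem log_valuation_points : ∀ i j : Fin 3,
    WithZero.log ((![v₀, v₁, v₂] j).valuation K
      ((![(1053 : 𝓞 K), (151263 : 𝓞 K), (-20072 : 𝓞 K) - 27521 * ζ] i : 𝓞 K) : K)) =
      -((![![4, 1, 1], ![2, 0, 0], ![0, 1, 4]] : Fin 3 → Fin 3 → ℕ) i j : ℤ) := by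
  have hsq := sq_add_one_eq_zero hζ
  obtain ⟨hℓ₀, hℓ₁, hℓ₂⟩ := natCast_mem_places hζ hv₀ hv₁ hv₂
  have hπ₁ : (2 : 𝓞 K) + 3 * ζ ∈ v₁.asIdeal := by rw [hv₁]; exact mem_span_singleton_self _
  have hπ₂ : (2 : 𝓞 K) - 3 * ζ ∈ v₂.asIdeal := by rw [hv₂]; exact mem_span_singleton_self _
  have c00 : WithZero.log (v₀.valuation K (((1053 : 𝓞 K) : 𝓞 K) : K)) = -4 := by
    rw [log_valuation_eq_neg_of_eq_pow_mul hv₀ 4 (y := ((13 : ℤ) : 𝓞 K)) (by push_cast; ring)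
      (intCast_not_mem_of_not_dvd (ℓ := 3) Nat.prime_three hℓ₀ (by norm_num))]
    norm_num
  have c01 : WithZero.log (v₁.valuation K (((1053 : 𝓞 K) : 𝓞 K) : K)) = -1 := by
    rw [log_valuation_eq_neg_of_eq_pow_mul hv₁ 1 (y := ((162 : 𝓞 K) - 243 * ζ)) (by linear_combination ((729 : 𝓞 K)) * hsq)
      (not_mem_of_eq_mul_add_intCast (ℓ := 13) (by norm_num) hℓ₁ hπ₁ (z := ((-33 : 𝓞 K) - 72 * ζ)) (d := 12)
        (by push_cast; linear_combination ((216 : 𝓞 K)) * hsq) (by norm_num))]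
    norm_num
  have c02 : WithZero.log (v₂.valuation K (((1053 : 𝓞 K) : 𝓞 K) : K)) = -1 := by
    rw [log_valuation_eq_neg_of_eq_pow_mul hv₂ 1 (y := ((162 : 𝓞 K) + 243 * ζ)) (by linear_combination ((729 : 𝓞 K)) * hsq)
      (not_mem_of_eq_mul_add_intCast (ℓ := 13) (by norm_num) hℓ₂ hπ₂ (z := ((-33 : 𝓞 K) + 72 * ζ)) (d := 12)
        (by push_cast; linear_combination ((216 : 𝓞 K)) * hsq) (by norm_num))]
    norm_num
  have c10 : WithZero.log (v₀.valuation K (((151263 : 𝓞 K) : 𝓞 K) : K)) = -2 := by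
    rw [log_valuation_eq_neg_of_eq_pow_mul hv₀ 2 (y := ((16807 : ℤ) : 𝓞 K)) (by push_cast; ring)
      (intCast_not_mem_of_not_dvd (ℓ := 3) Nat.prime_three hℓ₀ (by norm_num))]
    norm_num
  have c11 : WithZero.log (v₁.valuation K (((151263 : 𝓞 K) : 𝓞 K) : K)) = -0 := by
    rw [log_valuation_eq_neg_of_eq_pow_mul hv₁ 0 (y := (151263 : 𝓞 K)) (by ring)
      (not_mem_of_eq_mul_add_intCast (ℓ := 13) (by norm_num) hℓ₁ hπ₁ (z := ((23270 : 𝓞 K) - 34905 * ζ)) (d := 8)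
        (by push_cast; linear_combination ((104715 : 𝓞 K)) * hsq) (by norm_num))]
    norm_num
  have c12 : WithZero.log (v₂.valuation K (((151263 : 𝓞 K) : 𝓞 K) : K)) = -0 := by
    rw [log_valuation_eq_neg_of_eq_pow_mul hv₂ 0 (y := (151263 : 𝓞 K)) (by ring)
      (not_mem_of_eq_mul_add_intCast (ℓ := 13) (by norm_num) hℓ₂ hπ₂ (z := ((23270 : 𝓞 K) + 34905 * ζ)) (d := 8)
        (by push_cast; linear_combination ((104715 : 𝓞 K)) * hsq) (by norm_num))]
    norm_num
  have c20 : WithZero.log (v₀.valuation K ((((-20072 : 𝓞 K) - 27521 * ζ) : 𝓞 K) : K)) = -0 := by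
    rw [log_valuation_eq_neg_of_eq_pow_mul hv₀ 0 (y := ((-20072 : ℤ) : 𝓞 K) + ((-27521 : ℤ) : 𝓞 K) * ζ) (by push_cast; ring)
      (by rw [hv₀]; exact int_add_int_mul_not_mem_span_natCast hζ (q := 3) (by norm_num))]
    norm_num
  have c21 : WithZero.log (v₁.valuation K ((((-20072 : 𝓞 K) - 27521 * ζ) : 𝓞 K) : K)) = -1 := by
    rw [log_valuation_eq_neg_of_eq_pow_mul hv₁ 1 (y := ((-9439 : 𝓞 K) + 398 * ζ)) (by linear_combination ((-1194 : 𝓞 K)) * hsq)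
      (not_mem_of_eq_mul_add_intCast (ℓ := 13) (by norm_num) hℓ₁ hπ₁ (z := ((-1362 : 𝓞 K) + 2242 * ζ)) (d := 11)
        (by push_cast; linear_combination ((-6726 : 𝓞 K)) * hsq) (by norm_num))]
    norm_num
  have c22 : WithZero.log (v₂.valuation K ((((-20072 : 𝓞 K) - 27521 * ζ) : 𝓞 K) : K)) = -4 := by
    rw [log_valuation_eq_neg_of_eq_pow_mul hv₂ 4 (y := ((-32 : 𝓞 K) + 199 * ζ)) (by linear_combination ((-19560 : 𝓞 K) + (-33777 : 𝓞 K) * ζ + (45576 : 𝓞 K) * ζ ^ 2 + (-16119 : 𝓞 K) * ζ ^ 3) * hsq)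
      (not_mem_of_eq_mul_add_intCast (ℓ := 13) (by norm_num) hℓ₂ hπ₂ (z := ((-51 : 𝓞 K) + 23 * ζ)) (d := 1)
        (by push_cast; linear_combination ((69 : 𝓞 K)) * hsq) (by norm_num))]
    norm_num
  intro i j
  fin_cases i <;> fin_cases j
  · simpa using c00
  · simpa using c01
  · simpa using c02
  · simpa using c10
  · simpa using c11
  · simpa using c12
  · simpa using c20
  · simpa using c21
  · simpa using c22

omit [IsCyclotomicExtension {4} ℚ K] in
/-- **Orders of the base value `f_T(2T) = 19773 = 3²·13³`**: `[2, 3, 3]`. [cite: SilvermanAEC2009, Exercise 10.1(c)] -/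
theorem log_valuation_base : ∀ j : Fin 3,
    WithZero.log ((![v₀, v₁, v₂] j).valuation K (((19773 : 𝓞 K) : 𝓞 K) : K)) = -((![2, 3, 3] : Fin 3 → ℕ) j : ℤ) := by
  have hsq := sq_add_one_eq_zero hζ
  obtain ⟨hℓ₀, hℓ₁, hℓ₂⟩ := natCast_mem_places hζ hv₀ hv₁ hv₂
  have hπ₁ : (2 : 𝓞 K) + 3 * ζ ∈ v₁.asIdeal := by rw [hv₁]; exact mem_span_singleton_self _
  have hπ₂ : (2 : 𝓞 K) - 3 * ζ ∈ v₂.asIdeal := by rw [hv₂]; exact mem_span_singleton_self _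
  have c30 : WithZero.log (v₀.valuation K (((19773 : 𝓞 K) : 𝓞 K) : K)) = -2 := by
    rw [log_valuation_eq_neg_of_eq_pow_mul hv₀ 2 (y := ((2197 : ℤ) : 𝓞 K)) (by push_cast; ring)
      (intCast_not_mem_of_not_dvd (ℓ := 3) Nat.prime_three hℓ₀ (by norm_num))]
    norm_num
  have c31 : WithZero.log (v₁.valuation K (((19773 : 𝓞 K) : 𝓞 K) : K)) = -3 := by
    rw [log_valuation_eq_neg_of_eq_pow_mul hv₁ 3 (y := ((-414 : 𝓞 K) - 81 * ζ)) (by linear_combination ((23085 : 𝓞 K) + (15552 : 𝓞 K) * ζ + (2187 : 𝓞 K) * ζ ^ 2) * hsq)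
      (not_mem_of_eq_mul_add_intCast (ℓ := 13) (by norm_num) hℓ₁ hπ₁ (z := ((-83 : 𝓞 K) + 84 * ζ)) (d := 4)
        (by push_cast; linear_combination ((-252 : 𝓞 K)) * hsq) (by norm_num))]
    norm_num
  have c32 : WithZero.log (v₂.valuation K (((19773 : 𝓞 K) : 𝓞 K) : K)) = -3 := by
    rw [log_valuation_eq_neg_of_eq_pow_mul hv₂ 3 (y := ((-414 : 𝓞 K) + 81 * ζ)) (by linear_combination ((23085 : 𝓞 K) + (-15552 : 𝓞 K) * ζ + (2187 : 𝓞 K) * ζ ^ 2) * hsq)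
      (not_mem_of_eq_mul_add_intCast (ℓ := 13) (by norm_num) hℓ₂ hπ₂ (z := ((-83 : 𝓞 K) - 84 * ζ)) (d := 4)
        (by push_cast; linear_combination ((-252 : 𝓞 K)) * hsq) (by norm_num))]
    norm_num
  intro j
  fin_cases j
  · simpa using c30
  · simpa using c31
  · simpa using c32

omit [IsCyclotomicExtension {4} ℚ K] in
/-- **`32 = 2⁵` is a unit at the three places** (`v(32) = 0`): the denominator of `f_T(Q) = (−20072 − 27521ζ)/32` does not
change the orders. [cite: IrelandRosen1982, Ch. 9 §7] -/
theorem log_valuation_thirtytwo : ∀ j : Fin 3,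
    WithZero.log ((![v₀, v₁, v₂] j).valuation K (((32 : 𝓞 K) : 𝓞 K) : K)) = 0 := by
  obtain ⟨hℓ₀, hℓ₁, hℓ₂⟩ := natCast_mem_places hζ hv₀ hv₁ hv₂
  have c0 : WithZero.log (v₀.valuation K (((32 : 𝓞 K) : 𝓞 K) : K)) = 0 := by
    rw [log_valuation_eq_neg_of_eq_pow_mul hv₀ 0 (y := ((32 : ℤ) : 𝓞 K)) (by push_cast; ring)
      (intCast_not_mem_of_not_dvd (ℓ := 3) Nat.prime_three hℓ₀ (by norm_num))]
    norm_num
  have c1 : WithZero.log (v₁.valuation K (((32 : 𝓞 K) : 𝓞 K) : K)) = 0 := by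
    rw [log_valuation_eq_neg_of_eq_pow_mul hv₁ 0 (y := ((32 : ℤ) : 𝓞 K)) (by push_cast; ring)
      (intCast_not_mem_of_not_dvd (ℓ := 13) (by norm_num) hℓ₁ (by norm_num))]
    norm_num
  have c2 : WithZero.log (v₂.valuation K (((32 : 𝓞 K) : 𝓞 K) : K)) = 0 := by
    rw [log_valuation_eq_neg_of_eq_pow_mul hv₂ 0 (y := ((32 : ℤ) : 𝓞 K)) (by push_cast; ring)
      (intCast_not_mem_of_not_dvd (ℓ := 13) (by norm_num) hℓ₂ (by norm_num))]
    norm_num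
  intro j
  fin_cases j
  · simpa using c0
  · simpa using c1
  · simpa using c2

end Table

end KubertTate133GaussianDescent

end Literature.NumberTheory.EllipticCurves

end
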